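import Summits.QuantumAdvantage.QuantumAdvantage.Theorems.CubicForrelationSignedExactCubicForrelationNotPrBPPGrowMachineRounds
import Summits.QuantumAdvantage.QuantumAdvantage.Theorems.CubicForrelationSignedExactCubicForrelationNotPrBPPGrowMachine

/-!
# Crux `CubicForrelation.SignedExactCubicForrelationNotPrBPP` (stmt-QuantumAdvantage-13932), line `dual-pingpong-frame`
# (GROW reshape): the GROW machine, VIII — the steps and trials keep the invariant, make progress, and accept good candidates

Proof-only support file (`--supports stmt-QuantumAdvantage-13932`) toward the registered stub `stub_growFinder`; sequel
of `…GrowMachineRounds.lean`. The INVARIANT of a state `(S, U)` (parameter `Inv`, `hInv`): `S` and `U` are bases of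
length `≤ m`, the spans are closed both ways (`Clg (span S) (span U)`, `Clf (span U) (span S)`) and orthogonal.

* `tryB_sound` — an accepted `b`-side step returns a state satisfying the invariant whose potential `|S| + |U|` is larger
  (the acceptance test is read through `closedChk_sound` / `orthChk_eq_true_iff`; the candidate was outside `span S`);
* `tryB_complete` — **a GOOD candidate is accepted**: if the candidate lies in a closed orthogonal pair `(V, W)` of
  subspaces of size `2^m` containing `(span S, span U)` (for an M-subspace `V ∋ v` of `g` orthogonal to `U` this is the
  line's hypothesis `MPairClosed` with `W = V^⊥`) and outside `span S`, the step accepts (`closure_closed`);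
* the `a`-side versions by the swap symmetry of the invariant, the jobs `tryJob`, and the trials: `trialC` keeps the
  invariant, either fixes the state or raises the potential, fixes terminal states, and CHANGES a non-terminal state as
  soon as one job would accept (`trialC_ne_self`).

## References

* C. Carlet, *Boolean Functions for Cryptography and Coding Theory*, CUP 2021, Prop. 54. [Carlet2020]
* D. E. Knuth, *TAOCP* Vol. 2, 3rd ed., §4.6.2 Algorithm N. [KnuthTAOCP2]
-/

noncomputable section

set_option linter.dupNamespace false -- D-0017: single-problem summit ⇒ `QuantumAdvantage.QuantumAdvantage` by design

namespace Summit.QuantumAdvantage.QuantumAdvantage.Theorems.SignedExactCubicForrelationNotPrBPP.GrowMachine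

open Finset
open Literature.Computability.Complexity Literature.Computability.QuantumComplexity
open Literature.Computability.Complexity.F2Elim
open Literature.Computability.Complexity.BLR (toZ toZ_xor toZ_and toZ_injective)
open Literature.Computability.QuantumComplexity.BuzetChailloux (bxor zeroVec bxor_self bxor_comm bxor_zeroVec zeroVec_bxor)
open PolarGeometry (toZ_bdot bdot_comm bdot_bxor_left bdot_bxor_right)
open NoTrap (bdot_zeroVec bdot_unit D_symm D_bxor_left D_zeroVec_eq)
open ForrCode QuadSampler MMReadout
open FinderMachine (Vec Mat normV basisOf kerOf inSpan)

variable {n m : ℕ}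

section Steps

variable {f g : (Fin n → Bool) → Bool} (Df Dg : (Fin n → Bool) → (Fin n → Bool) → (Fin n → Bool) → Bool)
  (hDf : ∀ u v x, Df u v x = (f x ^^ f (bxor x u) ^^ f (bxor x v) ^^ f (bxor x (bxor u v))))
  (hDg : ∀ u v x, Dg u v x = (g x ^^ g (bxor x u) ^^ g (bxor x v) ^^ g (bxor x (bxor u v))))
  {cf cg : PCirc} (hf : ∀ v, evalP cf v = f (toInput n v)) (hg : ∀ v, evalP cg v = g (toInput n v))
  (hf3 : IsDegLeFun 3 f) (hg3 : IsDegLeFun 3 g)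
  (Clf Clg : Finset (Fin n → Bool) → Finset (Fin n → Bool) → Prop)
  (hClf : ∀ A B, Clf A B ↔
    ((∀ s ∈ A, ∀ y : Fin n → Bool, (fun k => (Df s y zeroVec ^^ Df s y (fun j => decide (j = k)))) ∈ B) ∧
     (∀ s ∈ A, ∃ ℓ ∈ B, ∀ r : Fin n → Bool, (∀ y z : Fin n → Bool, (Df s r z ^^ Df s r (bxor z y)) = false) →
        Df s r zeroVec = (univ.filter fun i => ℓ i && r i).card.bodd)))
  (hClg : ∀ A B, Clg A B ↔
    ((∀ s ∈ A, ∀ y : Fin n → Bool, (fun k => (Dg s y zeroVec ^^ Dg s y (fun j => decide (j = k)))) ∈ B) ∧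
     (∀ s ∈ A, ∃ ℓ ∈ B, ∀ r : Fin n → Bool, (∀ y z : Fin n → Bool, (Dg s r z ^^ Dg s r (bxor z y)) = false) →
        Dg s r zeroVec = (univ.filter fun i => ℓ i && r i).card.bodd)))
  (Inv : Mat × Mat → Prop)
  (hInv : ∀ p, Inv p ↔
    ((spanV n p.1).card = 2 ^ p.1.length ∧ (spanV n p.2).card = 2 ^ p.2.length) ∧ (p.1.length ≤ m ∧ p.2.length ≤ m) ∧
      Clg (spanV n p.1) (spanV n p.2) ∧ Clf (spanV n p.2) (spanV n p.1) ∧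
      ∀ s ∈ spanV n p.1, ∀ u ∈ spanV n p.2, (univ.filter fun i => s i && u i).card.bodd = false)

/-! ### The `b`-side step -/

include hDf hDg hf hg hf3 hg3 hClf hClg hInv in
/-- **Soundness of the `b`-side step**: an accepted step keeps the invariant and raises the potential.
[cite: Carlet2020, Prop. 54] -/
theorem tryB_sound {p q : Mat × Mat} (hp : Inv p) {xs : Mat} {sel : Vec} (hq : tryB n m cf cg p xs sel = some q) :
    Inv q ∧ p.1.length + p.2.length + 1 ≤ q.1.length + q.2.length := by
  obtain ⟨⟨hb1, hb2⟩, -, -, -, -⟩ := (hInv p).1 hp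
  unfold tryB at hq
  split_ifs at hq with hin hok
  cases hq
  set v := candV n cg p.1 p.2 xs sel with hv
  set q₀ : Mat × Mat := (basisOf n (p.1 ++ [v]), p.2) with hq₀
  have hin' : inSpan n p.1 v = false := by simpa using hin
  obtain ⟨c1, c2, m1, m2⟩ := closure_basis_mono (cf := cf) (cg := cg) (q := q₀) (card_spanV_basisOf _) hb2
  simp only [okPair, Bool.and_eq_true, decide_eq_true_eq] at hok
  obtain ⟨⟨⟨⟨k1, k2⟩, l1⟩, l2⟩, ho⟩ := hok
  refine ⟨(hInv _).2 ⟨⟨c1, c2⟩, ⟨l1, l2⟩, closedChk_sound Dg hDg hg hg3 Clg hClg k1, closedChk_sound Df hDf hf hf3 Clf hClf k2,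
    (orthChk_eq_true_iff _ _).1 ho⟩, ?_⟩
  -- progress: `v ∉ span S` makes the `S`-side basis longer, and spans only grow
  have hlt : p.1.length < (basisOf n (p.1 ++ [v])).length :=
    length_lt_of_spanV_ssubset hb1 (card_spanV_basisOf _) (Finset.ssubset_iff_subset_ne.2
      ⟨spanV_subset_basisOf_append_left _ _, fun heq => by
        have hmem : toInput n v ∈ spanV n (basisOf n (p.1 ++ [v])) := toInput_mem_spanV_basisOf_append_right _ List.mem_cons_self
        rw [← heq, ← inSpan_eq_true_iff] at hmem
        rw [hmem] at hin'
        exact Bool.noConfusion hin'⟩)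
  have e1 := length_le_of_spanV_subset (card_spanV_basisOf _) c1 m1
  have e2 := length_le_of_spanV_subset hb2 c2 m2
  change (basisOf n (p.1 ++ [v])).length ≤ (closure n cf cg q₀).1.length at e1
  change p.2.length ≤ (closure n cf cg q₀).2.length at e2
  omega

include hDf hDg hf hg hf3 hg3 hClf hClg hInv in
/-- **Completeness of the `b`-side step: good candidates are accepted.** If the candidate `v` lies outside `span S` but
inside a closed orthogonal pair `(V, W)` of subspaces of size `2^m` containing `(span S, span U)` (`n = 2m`), the step
accepts. [cite: Carlet2020, Prop. 54] -/
theorem tryB_complete (hn : n = m + m) {p : Mat × Mat} (hp : Inv p) {V W : Finset (Fin n → Bool)}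
    (hV0 : zeroVec ∈ V) (hVadd : ∀ x ∈ V, ∀ y ∈ V, bxor x y ∈ V) (hW0 : zeroVec ∈ W) (hWadd : ∀ x ∈ W, ∀ y ∈ W, bxor x y ∈ W)
    (hVc : V.card = 2 ^ m) (hWc : W.card = 2 ^ m) (hgVW : Clg V W) (hfWV : Clf W V)
    (hVW : ∀ s ∈ V, ∀ u ∈ W, (univ.filter fun i => s i && u i).card.bodd = false)
    (hSV : spanV n p.1 ⊆ V) (hUW : spanV n p.2 ⊆ W) {xs : Mat} {sel : Vec}
    (hvV : toInput n (candV n cg p.1 p.2 xs sel) ∈ V) (hvS : toInput n (candV n cg p.1 p.2 xs sel) ∉ spanV n p.1) :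
    ∃ q, tryB n m cf cg p xs sel = some q := by
  obtain ⟨⟨hb1, hb2⟩, -, -, -, -⟩ := (hInv p).1 hp
  set v := candV n cg p.1 p.2 xs sel with hv
  set q₀ : Mat × Mat := (basisOf n (p.1 ++ [v]), p.2) with hq₀
  have hin : inSpan n p.1 v = false := by
    cases h : inSpan n p.1 v
    · rfl
    · exact absurd ((inSpan_eq_true_iff _ _).1 h) hvS
  have h1 : spanV n q₀.1 ⊆ V := spanV_basisOf_append_subset hV0 hVadd hSV fun x hx => by
    rw [List.mem_singleton.1 hx]; exact hvV
  obtain ⟨i1, i2, k1, k2⟩ := closure_closed Df Dg hDf hDg hf hg hf3 hg3 Clf Clg hClf hClg hn hV0 hVadd hW0 hWadd hVc hWc hgVW hfWV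
    (q := q₀) (card_spanV_basisOf _) hb2 h1 hUW
  obtain ⟨c1, c2, -, -⟩ := closure_basis_mono (cf := cf) (cg := cg) (q := q₀) (card_spanV_basisOf _) hb2
  have l1 := length_le_of_spanV_subset_card c1 hVc i1
  have l2 := length_le_of_spanV_subset_card c2 hWc i2
  have ho : orthChk n (closure n cf cg q₀).1 (closure n cf cg q₀).2 = true :=
    (orthChk_eq_true_iff _ _).2 fun s hs u hu => hVW s (i1 hs) u (i2 hu)
  refine ⟨closure n cf cg q₀, ?_⟩
  rw [tryB, if_neg (by rw [hin]; exact Bool.false_ne_true), if_pos]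
  simp only [okPair, Bool.and_eq_true, decide_eq_true_eq]
  exact ⟨⟨⟨⟨k1, k2⟩, l1⟩, l2⟩, ho⟩

end Steps

/-! ### The `a`-side step, jobs and trials (swap symmetry) -/

section Trials

variable {f g : (Fin n → Bool) → Bool} (Df Dg : (Fin n → Bool) → (Fin n → Bool) → (Fin n → Bool) → Bool)
  (hDf : ∀ u v x, Df u v x = (f x ^^ f (bxor x u) ^^ f (bxor x v) ^^ f (bxor x (bxor u v))))
  (hDg : ∀ u v x, Dg u v x = (g x ^^ g (bxor x u) ^^ g (bxor x v) ^^ g (bxor x (bxor u v))))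
  {cf cg : PCirc} (hf : ∀ v, evalP cf v = f (toInput n v)) (hg : ∀ v, evalP cg v = g (toInput n v))
  (hf3 : IsDegLeFun 3 f) (hg3 : IsDegLeFun 3 g)
  (Clf Clg : Finset (Fin n → Bool) → Finset (Fin n → Bool) → Prop)
  (hClf : ∀ A B, Clf A B ↔
    ((∀ s ∈ A, ∀ y : Fin n → Bool, (fun k => (Df s y zeroVec ^^ Df s y (fun j => decide (j = k)))) ∈ B) ∧
     (∀ s ∈ A, ∃ ℓ ∈ B, ∀ r : Fin n → Bool, (∀ y z : Fin n → Bool, (Df s r z ^^ Df s r (bxor z y)) = false) →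
        Df s r zeroVec = (univ.filter fun i => ℓ i && r i).card.bodd)))
  (hClg : ∀ A B, Clg A B ↔
    ((∀ s ∈ A, ∀ y : Fin n → Bool, (fun k => (Dg s y zeroVec ^^ Dg s y (fun j => decide (j = k)))) ∈ B) ∧
     (∀ s ∈ A, ∃ ℓ ∈ B, ∀ r : Fin n → Bool, (∀ y z : Fin n → Bool, (Dg s r z ^^ Dg s r (bxor z y)) = false) →
        Dg s r zeroVec = (univ.filter fun i => ℓ i && r i).card.bodd)))
  (Inv : Mat × Mat → Prop)
  (hInv : ∀ p, Inv p ↔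
    ((spanV n p.1).card = 2 ^ p.1.length ∧ (spanV n p.2).card = 2 ^ p.2.length) ∧ (p.1.length ≤ m ∧ p.2.length ≤ m) ∧
      Clg (spanV n p.1) (spanV n p.2) ∧ Clf (spanV n p.2) (spanV n p.1) ∧
      ∀ s ∈ spanV n p.1, ∀ u ∈ spanV n p.2, (univ.filter fun i => s i && u i).card.bodd = false)

include hInv in
/-- The invariant is symmetric under the exchange of the two sides. [folklore] -/
theorem hInv_swap : ∀ p : Mat × Mat, (fun q : Mat × Mat => Inv q.swap) p ↔
    ((spanV n p.1).card = 2 ^ p.1.length ∧ (spanV n p.2).card = 2 ^ p.2.length) ∧ (p.1.length ≤ m ∧ p.2.length ≤ m) ∧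
      Clf (spanV n p.1) (spanV n p.2) ∧ Clg (spanV n p.2) (spanV n p.1) ∧
      ∀ s ∈ spanV n p.1, ∀ u ∈ spanV n p.2, (univ.filter fun i => s i && u i).card.bodd = false := by
  intro p
  show Inv p.swap ↔ _
  rw [hInv p.swap, Prod.fst_swap, Prod.snd_swap]
  constructor
  · rintro ⟨⟨a, b⟩, ⟨c, d⟩, e, f', o⟩
    exact ⟨⟨b, a⟩, ⟨d, c⟩, f', e, fun s hs u hu => by rw [bdot_comm]; exact o u hu s hs⟩
  · rintro ⟨⟨a, b⟩, ⟨c, d⟩, e, f', o⟩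
    exact ⟨⟨b, a⟩, ⟨d, c⟩, f', e, fun s hs u hu => by rw [bdot_comm]; exact o u hu s hs⟩

include hDf hDg hf hg hf3 hg3 hClf hClg hInv in
/-- **Soundness of the `a`-side step** (the `b`-side step of the swapped pair). [cite: Carlet2020, Prop. 54] -/
theorem tryA_sound {p q : Mat × Mat} (hp : Inv p) {xs : Mat} {sel : Vec} (hq : tryA n m cf cg p xs sel = some q) :
    Inv q ∧ p.1.length + p.2.length + 1 ≤ q.1.length + q.2.length := by
  unfold tryA at hq
  cases h : tryB n m cg cf p.swap xs sel with
  | none => rw [h] at hq; cases hq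
  | some q' =>
    rw [h] at hq
    cases hq
    have hp' : (fun q : Mat × Mat => Inv q.swap) p.swap := by show Inv p.swap.swap; rw [Prod.swap_swap]; exact hp
    have := tryB_sound Dg Df hDg hDf hg hf hg3 hf3 Clg Clf hClg hClf (fun q : Mat × Mat => Inv q.swap)
      (hInv_swap Clf Clg Inv hInv) hp' h
    obtain ⟨hI, hpot⟩ := this
    refine ⟨?_, ?_⟩
    · have : Inv q'.swap := hI
      exact this
    · simp only [Prod.fst_swap, Prod.snd_swap] at hpot ⊢
      omega

include hDf hDg hf hg hf3 hg3 hClf hClg hInv in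
/-- A successful job keeps the invariant and raises the potential. [cite: Carlet2020, Prop. 54] -/
theorem tryJob_sound {p q : Mat × Mat} (hp : Inv p) {xs : Mat} {sel : Vec} {j : ℕ} (hq : tryJob n m cf cg p xs sel j = some q) :
    Inv q ∧ p.1.length + p.2.length + 1 ≤ q.1.length + q.2.length := by
  unfold tryJob at hq
  split_ifs at hq
  · exact tryB_sound Df Dg hDf hDg hf hg hf3 hg3 Clf Clg hClf hClg Inv hInv hp hq
  · exact tryA_sound Df Dg hDf hDg hf hg hf3 hg3 Clf Clg hClf hClg Inv hInv hp hq

include hDf hDg hf hg hf3 hg3 hClf hClg hInv in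
/-- **A trial keeps the invariant and either fixes the state or raises the potential.** [cite: Carlet2020, Prop. 54] -/
theorem trialC_sound {p : Mat × Mat} (hp : Inv p) (c : Vec) :
    Inv (trialC n m cf cg p c) ∧ (trialC n m cf cg p c = p ∨ p.1.length + p.2.length + 1 ≤ (trialC n m cf cg p c).1.length + (trialC n m cf cg p c).2.length) := by
  unfold trialC; split_ifs
  · exact ⟨hp, Or.inl rfl⟩
  generalize hfs : List.findSome? _ _ = o
  cases o with
  | none => exact ⟨hp, Or.inl rfl⟩
  | some q =>
    obtain ⟨j, -, hj⟩ := List.exists_of_findSome?_eq_some hfs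
    have := tryJob_sound Df Dg hDf hDg hf hg hf3 hg3 Clf Clg hClf hClg Inv hInv hp hj
    exact ⟨this.1, Or.inr this.2⟩

/-- A terminal state is fixed by every trial. [folklore] -/
theorem trialC_of_terminal {cf cg : PCirc} {p : Mat × Mat} (h : terminal m p = true) (c : Vec) : trialC n m cf cg p c = p := by
  rw [trialC, if_pos h]

include hDf hDg hf hg hf3 hg3 hClf hClg hInv in
/-- **A non-terminal state changes as soon as one job would accept.** [cite: Carlet2020, Prop. 54] -/
theorem trialC_ne_self {p : Mat × Mat} (hp : Inv p) (ht : terminal m p = false) {c : Vec} {j : ℕ} (hj : j < 2 * (n + 2))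
    (hsome : ∃ q, tryJob n m cf cg p (probesOf n c) (selOf n c) j = some q) : trialC n m cf cg p c ≠ p := by
  rw [trialC, if_neg (by rw [ht]; exact Bool.false_ne_true)]
  cases hfs : (List.range (2 * (n + 2))).findSome? (tryJob n m cf cg p (probesOf n c) (selOf n c)) with
  | none =>
    rw [List.findSome?_eq_none_iff] at hfs
    obtain ⟨q, hq⟩ := hsome
    have := hfs j (List.mem_range.2 hj)
    rw [hq] at this
    cases this
  | some q =>
    obtain ⟨j', -, hj'⟩ := List.exists_of_findSome?_eq_some hfs
    intro heq
    have hpot := (tryJob_sound Df Dg hDf hDg hf hg hf3 hg3 Clf Clg hClf hClg Inv hInv hp hj').2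
    simp only [Option.getD_some] at heq
    rw [heq] at hpot
    omega

end Trials

/-- **Terminal states are fixed by every trial** (registered brick `grow_trialTerminal` of stub `stub_growFinder`, line `dual-pingpong-frame`, crux stmt-QuantumAdvantage-13932). [folklore] -/
theorem grow_trialTerminal : ∀ {n m : ℕ} {cf cg : ForrCode.PCirc} {p : List (List Bool) × List (List Bool)}, terminal m p = true → ∀ (c : List Bool), trialC n m cf cg p c = p :=
  fun h c => trialC_of_terminal h c

end Summit.QuantumAdvantage.QuantumAdvantage.Theorems.SignedExactCubicForrelationNotPrBPP.GrowMachine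

end
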